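import Summits.BirchSwinnertonDyer.BirchSwinnertonDyer.Theses.PrintX6
import Summits.BirchSwinnertonDyer.BirchSwinnertonDyer.Theorems.PrintX6EisensteinHalfFiveLeRestKimDeficitManinDatum
import Summits.BirchSwinnertonDyer.BirchSwinnertonDyer.Theorems.PrintX6EisensteinHalfFiveLeRestKimDeficitLevelCertificate
import Summits.BirchSwinnertonDyer.Rank1Residual.X4.KuriharaLowerHalf
import Literature.NumberTheory.EllipticCurves.Rank1Residual.Typed.X6
import Literature.NumberTheory.EllipticCurves.ModularParametrizationBCDTProofs
import Literature.NumberTheory.EllipticCurves.ModularityVersionApProofs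
import HarnessLib

/-!
# Line `kim-deficit` on crux `PrintX6.EisensteinHalfFiveLeRest` (stmt-BirchSwinnertonDyer-21116) — STUB 2, the
# ENGINE, «of inputs»: its Manin supply DISCHARGED from the route's own inputs (referee action C-77)

Route `PrintX6`, crux `EisensteinHalfFiveLeRest` (rank 211), registered line `kim_deficit`
(`Cruxes/EisensteinHalfFiveLeRest/Lines/kim_deficit.lean`, sha16 `35e5095fac56ab01`; director-bsd ROW 6 RULING
(154)(b): stubs 1–2 only; stub 3 — `∂^{(∞)}(δ̃) ≤ ord_p ∏ c_ℓ` on X6-Rest ∧ `r_an = 0`, ⟺ Kato's IMC for the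
class — is NOT attacked).

The by-name engine `KimDeficit.stub_missingLowerBoundAt_of_levelCertificate_X6_of_facts`
(`…KimDeficitEngine.lean`, p608837) displays THREE inputs in front of the registered signature of stub 2: the
route pack `PublishedInputsX6`, C.-H. Kim's structure theorem in the tree's UNTWINNED typing
`Kim2026.rankZero_le_padicValNat_sha_of_kuriharaNumber_ne_zero` (Amer. J. Math. 148 (2026) Thm. 1.8 (6)), and a
raw «MANIN SUPPLY» binder `hManin` (at a good `p ≥ 5` with `E[p]` irreducible, a modular parametrisation datum of
`W` at level `N_E` with Manin constant prime to `p`). The cell referee certified (C-77, evidence #55 on the item)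
that `hManin` is NOT a new input but a theorem over the route inputs, and asked for this corollary file. With the
LEAD's datum file `…KimDeficitManinDatum.lean` (p609432: `exists_datum_not_dvd_maninConstant_of_mazur`,
`exists_kimDatum_of_good_of_mazur` — Mazur 1978 Cor. 4.1 on the optimal curve transported along a prime-to-`p`
isogeny, Greenberg–Vatsal Rem. 3.4) the discharge needs ONE route input, `InputMazurManinOdd`: the newform to
start from is conjunct 7 of the pack (`nonempty_modularParametrizationData`, Modularity in BCDT's form (6)).

* §1 `inputNewformExistence_of_publishedInputsX6 : PublishedInputsX6 → InputNewformExistence` — Modularity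
  "Version L" (route item stmt-19382) is implied by the pack item stmt-20302 through the tree theorem
  `exists_isNewformOf_of_nonempty_modularParametrizationData` (a display; both sides are Modularity).
* §2 `exists_datum_not_dvd_maninConstant_of_inputs` — the Manin supply at every ODD good prime with `E[p]`
  irreducible, from `PublishedInputsX6 ∧ InputMazurManinOdd`; `maninSupply_of_inputs` = p608837's `hManin`
  binder VERBATIM (feed it to `…_of_facts` / `eisensteinHalfFiveLeRest_of_kimDeficit_of_facts`).
* §3 `stub_missingLowerBoundAt_of_levelCertificate_X6_of_inputs :
  PublishedInputsX6 → Kim2026.rankZero_le_padicValNat_sha_of_kuriharaNumber_ne_zero → InputMazurManinOdd →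
  ⟨registered signature of stub 2, verbatim⟩` — the `_of_facts` engine's binder list cut to {pack, Kim (6),
  Mazur} (pack conjuncts used: 4 period transfer, 7 a newform, 8 `L(E,1) ≠ 0 ⟺ r_an = 0`, 9 GZK).
* §4 `eisensteinHalfFiveLeRest_of_kimDeficit_of_inputs` — the line's composition reshaped accordingly: crux ⟸
  pack ∧ Kim (6) ∧ Mazur ∧ STUB 3 (hypothesis `h₃` = the registered signature of
  `stub_partialInfty_le_tamagawa_X6Rest`, verbatim), stub 1 USED BY NAME (p608466).

TIER CAVEAT (referee C-78, 2026-08-28): the Kim binder of §3–§4 is the UNTWINNED sibling, whose docstring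
carries the ARM-P flag `K26-(6)-shallow@t>0` (stronger than the printed proof at depth `k ≤ t`); by the cell's
rule R-0.7 a closure through it is tier-HELD. The FLAG-FREE closer of record for stub 2 is the LEAD's twin-keyed
`…KimDeficitEngineKimTwin.lean` (binder `Kim2026.rankZero_le_padicValNat_sha_of_kuriharaNumber_ne_zero_of_localTorsionTrivial`,
whose `(t0)` hypothesis `#E(ℚ_p)[p] = 1` is free on X6: good supersingular `p ≥ 5` ⇒ `a_p = 0`; engine layer
`X6RankZero.missingLowerBoundAt_of_kimLowerLT`; referee certificate `refG7_stub2_of_inputs_LT`). This file is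
the sibling-keyed companion completing action C-77 for the w2 lineage's engine p608837; it asserts nothing new
about any curve.

HONEST FRAMING: CONDITIONAL by-name theorems; every arithmetic input is a displayed hypothesis (the pack's nine
refereed facts, Kim 2026 Thm. 1.8 (6) in the flagged sibling typing, Mazur 1978 Cor. 4.1) and the hard stub 3
is a HYPOTHESIS, not attacked; nothing here credits a stub or closes the crux (the LEAD keeps stub 2 registered
as typed: a creditable re-registration would need Kim's theorem as a route item — planner TURNKEY, referee
C-78 (c)); the crux stays OPEN; no summit statement is proved; BSD is not proved by any of this. Lands
`--supports stmt-BirchSwinnertonDyer-21116 --as helper`.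
-/

set_option autoImplicit false
-- single-conjunct summit: the canonical namespace `Summit.BirchSwinnertonDyer.BirchSwinnertonDyer.…` repeats the name
set_option linter.dupNamespace false

noncomputable section

open scoped Classical MatrixGroups ModularForm

open CongruenceSubgroup WeierstrassCurve Literature.NumberTheory.EllipticCurves
  Literature.NumberTheory.EllipticCurves.ModularForms
  Literature.NumberTheory.EllipticCurves.Rank1Residual
  Literature.NumberTheory.EllipticCurves.Rank1Residual.Typed
  Summit.BirchSwinnertonDyer.Rank1Residual
  Summit.BirchSwinnertonDyer.Rank1Residual.Supersingular
  Summit.BirchSwinnertonDyer.BirchSwinnertonDyer.Theses.PrintX6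

namespace Summit.BirchSwinnertonDyer.BirchSwinnertonDyer.Theorems.PrintX6.KimDeficit

/-! ## §1 Modularity is already in the pack -/

/-- **Route item `InputNewformExistence` (stmt-19382) follows from the pack `PublishedInputsX6` (stmt-20302).**
Conjunct 7 of the pack is `nonempty_modularParametrizationData` (every globally minimal elliptic `W/ℚ` has a
modular parametrisation datum at level `N_E`: BCDT 2001 Thm. A in form (6)); the tree theorem
`exists_isNewformOf_of_nonempty_modularParametrizationData` (BCDT p. 845, (6) ⇒ (2): pass to a global minimal
model, take the datum's newform) turns it into Modularity "Version L" `exists_isNewformOf`, which is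
`InputNewformExistence` by definition. A display (both sides are Modularity), not a discharge of either item.
[cite: BCDTJAMS2001, Thm. A and p. 845, (6) ⇒ (2)] [cite: DiamondShurman2005, Thm. 8.8.3] -/
theorem inputNewformExistence_of_publishedInputsX6 (hPub : PublishedInputsX6) : InputNewformExistence :=
  exists_isNewformOf_of_nonempty_modularParametrizationData hPub.2.2.2.2.2.2.1

/-! ## §2 The Manin supply from the pack and Mazur 1978 Cor. 4.1 -/

/-- **The «Manin supply» at every odd good prime with `E[p]` irreducible, from the pack and
`InputMazurManinOdd`.** For `W/ℚ` globally minimal elliptic and `p` an odd prime of good reduction with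
`ρ̄_{E,p}` irreducible there is a modular parametrisation datum of `W` at level `N_E` whose Manin constant is
prime to `p`. Proof: a newform `f` of `W` at level `N_E` from pack conjunct 7; good reduction gives `p ∤ N_E`
(`dvd_conductorNorm_iff_not_hasGoodReductionAtPrime`), hence `p² ∤ N_E`; conclude by the LEAD's
`exists_datum_not_dvd_maninConstant_of_mazur` (p609432: Mazur Cor. 4.1 for the optimal curve, an admissible
constant prime to `p` along a prime-to-`p` isogeny). This is the referee's C-77 certificate
`refG6_hManin_of_inputs` with Modularity read off the pack instead of `InputNewformExistence`. CONDITIONAL on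
the two displayed inputs; works at every odd `p` (so also for the `p = 3` crux's Manin bookkeeping).
[cite: Mazur1978, Cor. 4.1] [cite: GreenbergVatsal2000, §3, Remark 3.4] [cite: BCDTJAMS2001, Thm. A] -/
theorem exists_datum_not_dvd_maninConstant_of_inputs (hPub : PublishedInputsX6)
    (hMaz : InputMazurManinOdd) (W : WeierstrassCurve ℚ) [W.IsElliptic] [W.IsGloballyMinimal]
    (p : ℕ) [Fact p.Prime] (hp2 : p ≠ 2) (hgood : W.HasGoodReductionAtPrime p)
    (hirr : W.HasIrreducibleModPGaloisRep p) [NeZero (W.conductorNorm ℤ)] :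
    ∃ D : ModularParametrizationData W (W.conductorNorm ℤ), ¬ (p : ℤ) ∣ D.maninConstant := by
  have hpN' : ¬ p ∣ W.conductorNorm ℤ := fun h ↦
    (W.dvd_conductorNorm_iff_not_hasGoodReductionAtPrime p).mp h hgood
  have hpN : ¬ p ^ 2 ∣ W.conductorNorm ℤ := fun h ↦ hpN' ((dvd_pow_self p two_ne_zero).trans h)
  -- a newform of `W` at level `N_E`: pack conjunct 7 (Modularity as parametrisation data)
  obtain ⟨D₀⟩ := hPub.2.2.2.2.2.2.1 W
  obtain ⟨D, -, hc⟩ := exists_datum_not_dvd_maninConstant_of_mazur hMaz W p hp2 hirr D₀.f D₀.isNewformOf hpN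
  exact ⟨D, hc⟩

/-- **The engine's `hManin` binder, verbatim, from the pack and `InputMazurManinOdd`** (the `5 ≤ p`
specialisation of `exists_datum_not_dvd_maninConstant_of_inputs`; literally the third hypothesis of
`KimDeficit.stub_missingLowerBoundAt_of_levelCertificate_X6_of_facts` and of
`KimDeficit.eisensteinHalfFiveLeRest_of_kimDeficit_of_facts`, `…KimDeficitEngine.lean`, p608837 — feed it there
to discharge their `hManin`). CONDITIONAL on the two displayed inputs.
[cite: Mazur1978, Cor. 4.1] [cite: BCDTJAMS2001, Thm. A] -/
theorem maninSupply_of_inputs (hPub : PublishedInputsX6) (hMaz : InputMazurManinOdd) :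
    ∀ (W : WeierstrassCurve ℚ) [W.IsElliptic] [W.IsGloballyMinimal] (p : ℕ) [Fact p.Prime],
      5 ≤ p → W.HasGoodReductionAtPrime p → W.HasIrreducibleModPGaloisRep p →
      ∀ [NeZero (W.conductorNorm ℤ)],
        ∃ D : ModularParametrizationData W (W.conductorNorm ℤ), ¬ (p : ℤ) ∣ D.maninConstant :=
  fun W _ _ p _ hp5 hgood hirr _ ↦
    exists_datum_not_dvd_maninConstant_of_inputs hPub hMaz W p (by omega) hgood hirr

/-! ## §3 STUB 2 by name modulo the pack, Kim 2026 Thm. 1.8 (6) (sibling typing) and Mazur 1978 Cor. 4.1 -/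

/-- **STUB 2 of line `kim-deficit` BY NAME, Manin supply discharged.** Displayed inputs: the route pack
`PublishedInputsX6` (stmt-20302 — used through conjunct 7, a newform; conjunct 8, `hasEntireLFunction_rat`, for
`L(E,1) ≠ 0 ⟺ r_an = 0`; conjunct 9, GZK), Kim 2026 Thm. 1.8 (6) at level `p^k` in the tree's untwinned typing
`Kim2026.rankZero_le_padicValNat_sha_of_kuriharaNumber_ne_zero` (ARM-P flag `K26-(6)-shallow@t>0`: tier HELD,
see the module docstring; the flag-free twin-keyed closer is the LEAD's `…KimDeficitEngineKimTwin.lean`), and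
the route input `InputMazurManinOdd` (stmt-19383, Mazur 1978 Cor. 4.1). Conclusion: the registered signature of
`stub_missingLowerBoundAt_of_levelCertificate_X6` VERBATIM — on X6 ∧ `p ≥ 5` ∧ `r_an = 0`, a Kurihara
certificate of level `k ≤ ord_p ∏ c_ℓ + 1` for every newform of `W` gives the LOWER half
`ord_p #Ш_an ≤ ord_p #Ш` (`Typed.MissingLowerBoundAt W p`). Proof = the `_of_facts` engine (p608837) with
`hManin := maninSupply_of_inputs`: `ρ̄` irreducible / onto from `ClassX6.irr` / `ClassX6.surj`; the datum `D`
of §2; the period transfer for `D.f` (pack conjunct 4); `L(E,1) ≠ 0` from `r_an = 0` (conjunct 8); the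
certificate `(k, n, ψ)` at `D.f`; then `X4.missingLowerBoundAt_rankZero_of_kimLower` (GZK = conjunct 9).
CONDITIONAL; credits nothing (the stub stays registered as typed).
[cite: Kim2022StructureSelmer, Thm. 1.9 (6) (PDF p. 8) and §1.5.1–1.5.3 (PDF pp. 7–8)]
[cite: Mazur1978, Cor. 4.1] [cite: GreenbergVatsal2000, §3, Remark 3.4] [cite: Miller2011LMS, Def. 1.1] -/
theorem stub_missingLowerBoundAt_of_levelCertificate_X6_of_inputs
    (hPub : PublishedInputsX6)
    (hKimk : Kim2026.rankZero_le_padicValNat_sha_of_kuriharaNumber_ne_zero)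
    (hMaz : InputMazurManinOdd) :
    ∀ (W : WeierstrassCurve ℚ) [W.IsElliptic] [W.IsGloballyMinimal] (p : ℕ) [Fact p.Prime],
      5 ≤ p → ClassX6 W p → W.analyticRank = 0 →
      (∀ [NeZero (W.conductorNorm ℤ)] (f : CuspForm (Gamma0 (W.conductorNorm ℤ)) 2), IsNewformOf W f →
        ∃ (k n : ℕ) (_ : NeZero n), 1 ≤ k ∧ k ≤ padicValNat p W.tamagawaProduct + 1 ∧
          Kato.IsKolyvaginProduct W p k n ∧
          (∀ (ℓ : ℕ) [Fact ℓ.Prime], ℓ ∣ n →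
            Nat.card {P : ((WeierstrassCurve.integralModelInt W).map
                (Int.castRingHom (ZMod ℓ))).toAffine.Point // p • P = 0} ≤ p) ∧
          ∃ ψ : (ℓ : ℕ) → (ZMod ℓ)ˣ →* Multiplicative (ZMod (p ^ k)),
            (∀ ℓ ∈ n.primeFactors, Function.Surjective (ψ ℓ)) ∧
              kuriharaNumber f (p ^ k) n ψ ≠ 0) →
      MissingLowerBoundAt W p := by
  intro W _ _ p _ hp5 hX hr0 hcert
  have hp2 : p ≠ 2 := by omega
  have hirr : Irr W p := ClassX6.irr W p hp2 hX
  have hsurj : Surj W p := ClassX6.surj W p hp2 hX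
  haveI : NeZero (W.conductorNorm ℤ) := ⟨(W.conductorNorm_pos_holds).ne'⟩
  -- the Manin supply, discharged (§2): a datum `D` at level `N_E` with `p ∤ c_D`
  obtain ⟨D, hc⟩ := maninSupply_of_inputs hPub hMaz W p hp5 hX.1.1 hirr
  obtain ⟨-, -, -, hϖ, -, -, -, hmod, hGZK⟩ := hPub
  have hL : W.entireLFunction 1 ≠ 0 := (W.analyticRank_eq_zero_iff_holds (hmod W)).1 hr0
  -- period transfer for the datum's newform (pack conjunct 4) and the certificate at `D.f`
  have hper : ∃ u : ℚ, ‖(u : ℚ_[p])‖ = 1 ∧ W.realPeriodRat = u * plusPeriod D.f :=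
    hϖ W p hp5 hX.1.1 hirr D.f D.isNewformOf
  obtain ⟨k, n, hn0, hk1, hkt, hk, hcyc, ψ, hψ, hne⟩ := hcert D.f D.isNewformOf
  haveI : NeZero n := hn0
  exact X4.missingLowerBoundAt_rankZero_of_kimLower W p hKimk hGZK hp5 hsurj hL D hc hper k n hk1 hkt hk
    (fun ℓ _ hℓ => hcyc ℓ hℓ) ψ hψ hne

/-! ## §4 The line's composition: crux ⟸ pack ∧ Kim (6) ∧ Mazur ∧ STUB 3 -/

/-- **The composition of line `kim-deficit` BY NAME with the Manin supply discharged: crux ⟸ pack ∧ Kim 2026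
Thm. 1.8 (6) (sibling typing) ∧ Mazur 1978 Cor. 4.1 ∧ STUB 3.** With stub 1 USED BY NAME (p608466,
`KimDeficit.stub_levelCertificate_of_partialInfty_le`, = `X4.exists_certificate_of_kuriharaPartialInfty_le`
re-keyed) and stub 2 the by-name engine of §3, the crux `Theses.PrintX6.EisensteinHalfFiveLeRest` follows from
the three displayed print inputs and the HARD stub 3 `stub_partialInfty_le_tamagawa_X6Rest`, taken as the
HYPOTHESIS `h₃` verbatim (⟺ the `≤` half of Kim's Conjecture 1.10 on X6-Rest ∧ `r_an = 0`; NOT attacked,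
director ROW 6 RULING (154)(b)); the crux's rational `q` is identified with `#Ш_an` by injectivity of `ℚ → ℂ`.
So, modulo refereed print (tier caveat of §3 on the Kim typing), the line's class-level residual is exactly
stub 3. CONDITIONAL; closes nothing; the crux stays open; BSD is not proved by any of this.
[cite: Kim2022StructureSelmer, Thm. 1.9 (6) and Conj. 1.10 (PDF p. 8)] [cite: Mazur1978, Cor. 4.1]
[cite: Miller2011LMS, Def. 1.1] -/
theorem eisensteinHalfFiveLeRest_of_kimDeficit_of_inputs
    (hPub : PublishedInputsX6)
    (hKimk : Kim2026.rankZero_le_padicValNat_sha_of_kuriharaNumber_ne_zero)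
    (hMaz : InputMazurManinOdd)
    (h₃ : ∀ (W : WeierstrassCurve ℚ) [W.IsElliptic] [W.IsGloballyMinimal] (p : ℕ) [Fact p.Prime],
      ¬ W.HasCM → 5 ≤ p → ClassX6 W p → W.analyticRank = 0 → ¬ HasErratumPrime W p →
      ∀ [NeZero (W.conductorNorm ℤ)] (f : CuspForm (Gamma0 (W.conductorNorm ℤ)) 2), IsNewformOf W f →
        kuriharaPartialInfty W p f ≤ (padicValNat p W.tamagawaProduct : ℕ∞)) :
    Summit.BirchSwinnertonDyer.BirchSwinnertonDyer.Theses.PrintX6.EisensteinHalfFiveLeRest := by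
  intro W _ _ p _ hCM hp5 hX hr0 hRest q hq _hvq
  have hlow : MissingLowerBoundAt W p := by
    refine stub_missingLowerBoundAt_of_levelCertificate_X6_of_inputs hPub hKimk hMaz W p hp5 hX hr0 ?_
    intro _ f hf
    exact stub_levelCertificate_of_partialInfty_le W p f (padicValNat p W.tamagawaProduct)
      (h₃ W p hCM hp5 hX hr0 hRest f hf)
  obtain ⟨q', hq', hle⟩ := hlow
  have hqq : q = q' := by exact_mod_cast hq.symm.trans hq'
  subst hqq
  exact hle

end Summit.BirchSwinnertonDyer.BirchSwinnertonDyer.Theorems.PrintX6.KimDeficit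

end
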